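import Summits.CriticalPhenomena.PercolationContinuityZ3.Theorems.PercNearOneGluingNoHeavyLowerTailKnQuestion8CoefficientwiseRootEdgeDomination
import HarnessLib

/-!
# The FLIP-PAIRING reduction of root-edge domination (REM): REM is at least its flip-residual sum — prim-lf-2 gen 67

Support file (`--supports stmt-CriticalPhenomena-4575`, closed), prover `prim-lf-2` (gen 67).  No definitions, no named facts, no sorries; standard axioms.
Memo `prim-lf-2/CW-FLIP-gen67.md` §1.

Setting (CONJECTURE (REM), prim-lf-2 gen 66, `…CoefficientwiseRootEdgeDomination.lean`): finite multigraph `ends : ι → Sym2 V`, root edge `e ∈ E` with ends `{x,p}`,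
`p ≠ x`, target set `W`, `E' = E.erase e`, and for `t ⊆ E'` the clusters of `G − e`: `K₀ = C_x(t)`, `P = C_p(t)`, `B₀ = C_x(E'∖t)`, `P' = C_p(E'∖t)`
(`C_v(s) = openCluster (ends '' s) v`).  By `rem_eq_sum_erase`, `REM = Σ_{t ∈ Ev¹} (g(K₀ ∪ P) − g(B₀))` with `Ev¹ = {t ⊆ E' : ∀ w ∈ W, ¬(w ∈ K₀ ∪ P ∧ w ∈ B₀)}`.
* `Coefficientwise.flip_pairing` — ABSTRACT LEMMA: if `B(t) ⊆ A(E∖t)` for all `t ⊆ E` then for every event `Q` and monotone `g`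
  `Σ_{t ⊆ E : Q t, ¬Q(E∖t)} (g(A t) − g(B t)) ≤ Σ_{t ⊆ E : Q t} (g(A t) − g(B t))`: the colour swap is an involution of `{Q t ∧ Q(E∖t)}` along which `g(B t) ≤ g(A(E∖t))`,
  so that part of the sum is `≥ 0`, and only the FLIP-RESIDUAL `{Q t ∧ ¬Q(E∖t)}` can be negative.
* `Coefficientwise.rem_residual_iff` — on `Ev¹`, the colour swap leaves `Ev¹` iff some target lies in `K₀ ∩ P'` (red-joined to `x` and blue-joined to `p` in `G − e`).
* `Coefficientwise.rem_ge_residual` — **REDUCTION**: `Σ_{t ∈ Ev¹ : E'∖t ∉ Ev¹} (g(K₀∪P) − g(B₀)) ≤ REM`, since `(K₀ ∪ P)(E'∖t) = B₀ ∪ P' ⊇ B₀(t)` always.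
* `Coefficientwise.rem_nonneg_of_residual` — hence the RESIDUAL CLAIM `0 ≤ Σ_{t ∈ Ev¹, ∃ w∈W, w ∈ K₀ ∩ P'} (g(K₀∪P) − g(B₀))` implies `REM ≥ 0`.
Census of the residual claim (prim-lf-2 gen 67, exact, one min-closure per `(G,e,W)`): all rooted connected graphs on ≤ 6 vertices (29 384 cases) and on 7 vertices with ≤ 13 edges
(620 927 cases): 0 failures; about 90 % of residual colourings even satisfy `B₀ ⊆ K₀ ∪ P` termwise.
[cite: KozmaNitzan2024, Questions 8–9 (§5.5 p. 36) (context: the Question-8 pocket covariance programme)]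
-/

namespace Summit.CriticalPhenomena.PercolationContinuityZ3.Theorems

open Finset Literature.Probability.Percolation

namespace Coefficientwise

variable {ι V : Type*} [DecidableEq ι]

open Classical in
/-- **Flip pairing (abstract).**  Let `A, B : Finset ι → Set V` satisfy `B t ⊆ A (E∖t)` for all `t ⊆ E`, let `Q` be any event and `g` monotone.  Then
`Σ_{t ⊆ E : Q t ∧ ¬ Q(E∖t)} (g(A t) − g(B t)) ≤ Σ_{t ⊆ E : Q t} (g(A t) − g(B t))`: on the swap-closed part `{Q t ∧ Q(E∖t)}` the colour swap is a bijection along which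
`g(B t) ≤ g(A(E∖t))`.  [cite: KozmaNitzan2024, §5.5 (context only; folklore)] -/
theorem flip_pairing (E : Finset ι) (Q : Finset ι → Prop) (A B : Finset ι → Set V)
    (hdom : ∀ t, t ⊆ E → B t ⊆ A (E \ t)) (g : Set V → ℝ) (hg : Monotone g) :
    ∑ t ∈ E.powerset.filter (fun t : Finset ι => Q t ∧ ¬ Q (E \ t)), (g (A t) - g (B t)) ≤
      ∑ t ∈ E.powerset.filter (fun t : Finset ι => Q t), (g (A t) - g (B t)) := by
  have hsplit : ∑ t ∈ E.powerset.filter (fun t : Finset ι => Q t), (g (A t) - g (B t)) =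
      ∑ t ∈ E.powerset.filter (fun t : Finset ι => Q t ∧ Q (E \ t)), (g (A t) - g (B t)) +
      ∑ t ∈ E.powerset.filter (fun t : Finset ι => Q t ∧ ¬ Q (E \ t)), (g (A t) - g (B t)) := by
    rw [← Finset.sum_filter_add_sum_filter_not (E.powerset.filter (fun t : Finset ι => Q t)) (fun t : Finset ι => Q (E \ t)),
      Finset.filter_filter, Finset.filter_filter]
  have hsym : 0 ≤ ∑ t ∈ E.powerset.filter (fun t : Finset ι => Q t ∧ Q (E \ t)), (g (A t) - g (B t)) := by
    have hQ2 : ∀ s, s ⊆ E → ((Q (E \ s) ∧ Q (E \ (E \ s))) ↔ (Q s ∧ Q (E \ s))) := by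
      intro s hs
      rw [Finset.sdiff_sdiff_eq_self hs]
      exact And.comm
    have hre := sum_powerset_filter_sdiff E (fun t : Finset ι => Q t ∧ Q (E \ t)) hQ2 (fun t => g (A t))
    rw [Finset.sum_sub_distrib, ← hre, ← Finset.sum_sub_distrib]
    refine Finset.sum_nonneg fun t ht => ?_
    have htE : t ⊆ E := Finset.mem_powerset.mp (Finset.mem_filter.mp ht).1
    exact sub_nonneg.mpr (hg (hdom t htE))
  linarith [hsplit, hsym]

open Classical in
/-- **The flip-residual of (REM).**  For `t ⊆ E' = E.erase e` in `Ev¹` (no target in `(K₀ ∪ P) ∩ B₀`), the swapped colouring `E'∖t` fails `Ev¹` iff some target lies in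
`K₀(t) ∩ P'(t)` (`P' = C_p(E'∖t)`): since `(K₀∪P)(E'∖t) = B₀ ∪ P'` and `B₀(E'∖t) = K₀`, and a target in `B₀ ∩ K₀` is excluded by `Ev¹(t)`.
[cite: KozmaNitzan2024, Questions 8–9 (§5.5 p. 36) (context)] -/
theorem rem_residual_iff (ends : ι → Sym2 V) (E' : Finset ι) {x p : V} (W : Set V) {t : Finset ι} (ht : t ⊆ E')
    (hEv : ∀ w ∈ W, ¬ (w ∈ openCluster (ends '' (↑t : Set ι)) x ∪ openCluster (ends '' (↑t : Set ι)) p ∧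
            w ∈ openCluster (ends '' (↑(E' \ t) : Set ι)) x)) :
    (¬ ∀ w ∈ W, ¬ (w ∈ openCluster (ends '' (↑(E' \ t) : Set ι)) x ∪ openCluster (ends '' (↑(E' \ t) : Set ι)) p ∧
            w ∈ openCluster (ends '' (↑(E' \ (E' \ t)) : Set ι)) x)) ↔
      ∃ w ∈ W, w ∈ openCluster (ends '' (↑t : Set ι)) x ∧ w ∈ openCluster (ends '' (↑(E' \ t) : Set ι)) p := by
  rw [Finset.sdiff_sdiff_eq_self ht]
  constructor
  · intro h
    by_contra hne
    apply h
    intro w hw hh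
    rcases hh with ⟨hBP, hK⟩
    rcases hBP with hB | hP'
    · exact hEv w hw ⟨Or.inl hK, hB⟩
    · exact hne ⟨w, hw, hK, hP'⟩
  · rintro ⟨w, hw, hK, hP'⟩ h
    exact h w hw ⟨Or.inr hP', hK⟩

open Classical in
/-- **REDUCTION: (REM) is at least its flip-residual sum.**  For a root edge `e ∈ E` (ends `{x,p}`, `p ≠ x`), `E' = E.erase e`, any `W` and monotone `g`:
`Σ_{t ⊆ E' : Ev¹(t), ¬Ev¹(E'∖t)} (g(C_x t ∪ C_p t) − g(C_x(E'∖t))) ≤ Σ_{s ⊆ E : e ∈ s, Ev_W(s)} (g(C_x s) − g(C_x(E∖s)))`,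
where `Ev¹(t) :⟺ ∀ w ∈ W, ¬(w ∈ C_x t ∪ C_p t ∧ w ∈ C_x(E'∖t))`.  (Resolve `e`, then `flip_pairing` with `A(t) = C_x t ∪ C_p t ⊇ C_x t = B(E'∖t)`.)
[cite: KozmaNitzan2024, Questions 8–9 (§5.5 p. 36) (context)] -/
theorem rem_ge_residual (ends : ι → Sym2 V) (E : Finset ι) {e : ι} (he : e ∈ E) {x p : V} (hxp : ends e = s(x, p)) (hpx : p ≠ x)
    (W : Set V) (g : Set V → ℝ) (hg : Monotone g) :
    ∑ t ∈ (E.erase e).powerset.filter (fun t : Finset ι =>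
          (∀ w ∈ W, ¬ (w ∈ openCluster (ends '' (↑t : Set ι)) x ∪ openCluster (ends '' (↑t : Set ι)) p ∧
            w ∈ openCluster (ends '' (↑((E.erase e) \ t) : Set ι)) x)) ∧
          ¬ (∀ w ∈ W, ¬ (w ∈ openCluster (ends '' (↑((E.erase e) \ t) : Set ι)) x ∪ openCluster (ends '' (↑((E.erase e) \ t) : Set ι)) p ∧
            w ∈ openCluster (ends '' (↑((E.erase e) \ ((E.erase e) \ t)) : Set ι)) x))),
      (g (openCluster (ends '' (↑t : Set ι)) x ∪ openCluster (ends '' (↑t : Set ι)) p) -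
        g (openCluster (ends '' (↑((E.erase e) \ t) : Set ι)) x)) ≤
    ∑ s ∈ E.powerset.filter (fun s : Finset ι => e ∈ s ∧
          ∀ w ∈ W, ¬ (w ∈ openCluster (ends '' (↑s : Set ι)) x ∧ w ∈ openCluster (ends '' (↑(E \ s) : Set ι)) x)),
      (g (openCluster (ends '' (↑s : Set ι)) x) - g (openCluster (ends '' (↑(E \ s) : Set ι)) x)) := by
  rw [rem_eq_sum_erase ends E he hxp hpx W g]
  set E' : Finset ι := E.erase e with hE'
  exact flip_pairing E'
    (fun t : Finset ι => ∀ w ∈ W, ¬ (w ∈ openCluster (ends '' (↑t : Set ι)) x ∪ openCluster (ends '' (↑t : Set ι)) p ∧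
      w ∈ openCluster (ends '' (↑(E' \ t) : Set ι)) x))
    (fun t : Finset ι => openCluster (ends '' (↑t : Set ι)) x ∪ openCluster (ends '' (↑t : Set ι)) p)
    (fun t : Finset ι => openCluster (ends '' (↑(E' \ t) : Set ι)) x)
    (fun t _ => Set.subset_union_left) g hg

open Classical in
/-- **COROLLARY: the residual claim implies (REM).**  If `0 ≤ Σ_{t ⊆ E' : Ev¹(t), ∃ w∈W, w ∈ C_x t ∧ w ∈ C_p(E'∖t)} (g(C_x t ∪ C_p t) − g(C_x(E'∖t)))`
(on the colourings of `G − e` with no target in `(K₀∪P) ∩ B₀` but some target red-joined to `x` and blue-joined to `p`, the two-source red cluster dominates the blue cluster of `x`),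
then `0 ≤ REM_E(e; x, W)[g] = Σ_{s ⊆ E : e ∈ s, Ev_W(s)} (g(C_x s) − g(C_x(E∖s)))`.  [cite: KozmaNitzan2024, Questions 8–9 (§5.5 p. 36) (context)] -/
theorem rem_nonneg_of_residual (ends : ι → Sym2 V) (E : Finset ι) {e : ι} (he : e ∈ E) {x p : V} (hxp : ends e = s(x, p)) (hpx : p ≠ x)
    (W : Set V) (g : Set V → ℝ) (hg : Monotone g)
    (hRes : 0 ≤ ∑ t ∈ (E.erase e).powerset.filter (fun t : Finset ι =>
          (∀ w ∈ W, ¬ (w ∈ openCluster (ends '' (↑t : Set ι)) x ∪ openCluster (ends '' (↑t : Set ι)) p ∧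
            w ∈ openCluster (ends '' (↑((E.erase e) \ t) : Set ι)) x)) ∧
          (∃ w ∈ W, w ∈ openCluster (ends '' (↑t : Set ι)) x ∧ w ∈ openCluster (ends '' (↑((E.erase e) \ t) : Set ι)) p)),
      (g (openCluster (ends '' (↑t : Set ι)) x ∪ openCluster (ends '' (↑t : Set ι)) p) -
        g (openCluster (ends '' (↑((E.erase e) \ t) : Set ι)) x))) :
    0 ≤ ∑ s ∈ E.powerset.filter (fun s : Finset ι => e ∈ s ∧
          ∀ w ∈ W, ¬ (w ∈ openCluster (ends '' (↑s : Set ι)) x ∧ w ∈ openCluster (ends '' (↑(E \ s) : Set ι)) x)),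
      (g (openCluster (ends '' (↑s : Set ι)) x) - g (openCluster (ends '' (↑(E \ s) : Set ι)) x)) := by
  refine le_trans ?_ (rem_ge_residual ends E he hxp hpx W g hg)
  set E' : Finset ι := E.erase e with hE'
  -- the two residual filters coincide
  have hfilter : (E'.powerset.filter (fun t : Finset ι =>
          (∀ w ∈ W, ¬ (w ∈ openCluster (ends '' (↑t : Set ι)) x ∪ openCluster (ends '' (↑t : Set ι)) p ∧
            w ∈ openCluster (ends '' (↑(E' \ t) : Set ι)) x)) ∧
          ¬ (∀ w ∈ W, ¬ (w ∈ openCluster (ends '' (↑(E' \ t) : Set ι)) x ∪ openCluster (ends '' (↑(E' \ t) : Set ι)) p ∧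
            w ∈ openCluster (ends '' (↑(E' \ (E' \ t)) : Set ι)) x)))) =
      (E'.powerset.filter (fun t : Finset ι =>
          (∀ w ∈ W, ¬ (w ∈ openCluster (ends '' (↑t : Set ι)) x ∪ openCluster (ends '' (↑t : Set ι)) p ∧
            w ∈ openCluster (ends '' (↑(E' \ t) : Set ι)) x)) ∧
          (∃ w ∈ W, w ∈ openCluster (ends '' (↑t : Set ι)) x ∧ w ∈ openCluster (ends '' (↑(E' \ t) : Set ι)) p))) := by
    refine Finset.filter_congr fun t ht => ?_
    have htE : t ⊆ E' := Finset.mem_powerset.mp ht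
    constructor
    · rintro ⟨h1, h2⟩; exact ⟨h1, (rem_residual_iff ends E' W htE h1).mp h2⟩
    · rintro ⟨h1, h2⟩; exact ⟨h1, (rem_residual_iff ends E' W htE h1).mpr h2⟩
  rw [hfilter]
  exact hRes

end Coefficientwise

end Summit.CriticalPhenomena.PercolationContinuityZ3.Theorems
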